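import Summits.BirchSwinnertonDyer.BirchSwinnertonDyer.Theorems.ByReductionTypeAtTwoAdditivePotGoodLowerHalfT0NarrowRankLayerParityRow279440c1
import Summits.BirchSwinnertonDyer.BirchSwinnertonDyer.Theorems.ByReductionTypeAtTwoAdditivePotGoodLowerHalfT0NarrowRankLayerTwoNonNormUnit
import Literature.NumberTheory.EllipticCurves.CyclotomicZpExtensionLayerOneSqrtTwoProofs
import HarnessLib

/-!
# K4 crux `AdditiveRankZeroAtTwo` (19098), children C3″ `AdditivePotGoodLowerHalfAtTwo` (22617) / C1″ (22615): census row `279440c1` — the displayed parity `hL`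
# of the rung-`m = 2` stamp DISCHARGED IN THE KERNEL: `h(A₃) = h(ℚ(θ) ⊔ ℚ_3)` is ODD (degree `24`; genus theory for `A₃/A₂` with the cubic unit `−u ≡ 5`
# at the degree-one dyadic prime, read at the prime of `A₂` above it with `e = 4`; row of discriminant `9980`)
# (seat `bsd-2adic-k4-w2` GEN 15; `--supports stmt-BirchSwinnertonDyer-22617 --as helper`)

Cell `bsd-2adic`.  THEOREMS ONLY (no definition, no named fact, no `sorry`).  KERNEL chain: `h(A₂)` odd (`…LayerParityRow279440c1`) and, for EVERY root `t` of `Ψ₂`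
in `A₂`, the unit `−u` of the cubic field (k4-w1's `u` of `…CoinvariantGenusCertificate9980LayerOne`, `−u − 5 = ξ⁶·c₆` — §1, exact certificate) is not a norm from
`A₂(√(2+t)) = A₃` (GEN 15's MODEL-FREE `exists_unit_forall_sq_sub_mul_sq_ne_of_layerOneData` fed with k4-w1's layer-one data at `s = t² − 2`: `𝔔 = (ξ, t)`,
`𝔔² = (ξ)`, principal since `h(A₂)` is odd, `N𝔔 = 2`, and the dyadic descent at `e = 4`); the generic parity step `odd_classNumber_sup_layer_succ_of_nonNormUnit`
at `m = 2` gives `h(A₃)` odd.  §3 re-keys the row: ★ `conjA_two_279440c1_of_layerBounds₂₃''` displays only (hlow) `2^3 ≤ #(U⁺/U²)(A₂)` and (hsig)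
`2^21 ≤ #sign(U_{A₃})` (VALUED GRH-free by eng-2 CERT-NARROW6-E2 v1.3 §6.1: `3` totally positive units of the degree-`12` field witnessed non-square, and the exact
signs of `23` units of the degree-`24` field), and the BSD₂ rungs follow.  Matches eng-2 v1.3 (`h(K₃)` odd by `rank_H = t − 1`); here KERNEL.

HONEST FRAMING (D-0036 / D-0054 / D-0152): conditional theorems (two instrument-tier unit data + PRINT inputs of the rungs); closes nothing at the `∀`-level
(C3″ 22617 / C1″ 22615 research-open); nothing booked; census tier of the row unchanged (CERT, hypothesis count 3 → 2: both class-number parities are now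
kernel); BSD is not proved by any of this.

References: [Lang1990] Ch. 13 §4 Lemma 4.1; [Gras2003] IV.4; [Omeara1963] §63A (63:3), §63B (63:10); [Washington1997] §13.1; [EdgarMollinPeterson1986] Thm. 2.1;
[CoatesSujatha2005] (A), Thm. 3.4; [Kato2004Asterisque] Thm. 12.5 (1)(3), 13.8, 14.14; [Cassels1965ArithmeticVIII] Thm. 1.3; [Miller2011LMS] Def. 1.1.
-/

set_option autoImplicit false
-- the Theorems namespace of this sub repeats the summit name by design (D-0017 nested layout)
set_option linter.dupNamespace false

noncomputable section

open scoped Classical IntermediateField NumberField Real nonZeroDivisors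

/-! ## §1–§2 `h(A₃)` odd (namespace `AddKatoTwo`) -/

namespace Summit.BirchSwinnertonDyer.BirchSwinnertonDyer.Theorems.AddKatoTwo

open WeierstrassCurve Field Polynomial IsDedekindDomain NumberField Matrix Literature.NumberTheory.EllipticCurves
  Literature.NumberTheory.EllipticCurves.ZpExtension
  Literature.NumberTheory.GaloisRepresentations
  Literature.NumberTheory.IwasawaTheory
  Literature.NumberTheory.NumberFields
  Literature.Geometry.Kaehler.ComplexTorus
  Summit.BirchSwinnertonDyer.BirchSwinnertonDyer.Theorems.SteinbergFibreAtTwo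
  Summit.BirchSwinnertonDyer.BirchSwinnertonDyer.Theorems.AlignedTransportAtTwoTorsionPointField
  Summit.BirchSwinnertonDyer.BirchSwinnertonDyer.Theses.ByReductionTypeAtTwo

/-- **The layer-two unit certificate of the cubic of discriminant `9980`**: `−u − 5 = ξ⁶·c₆` in `ℤ[generators]` (k4-w1's layer-one generators and relations;
`u` k4-w1's unit, `ξ` the prime above the degree-one dyadic prime), i.e. `−u ≡ 5 (mod ξ⁶)` — the cubic unit `−u` is `≡ 5 (mod 8)` at that prime.  Exact
certificate (seat tools `tools/sextic.py`, `tools/hLdata.py`). [folklore] [cite: Cohen1993, §4.8.2 and §6.3] -/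
theorem layer_two_unit_cert_d9980 {R : Type*} [CommRing R] (b x : R) (Rb : b ^ 3 - b ^ 2 - 36 * b - 70 = 0) (Rx : x ^ 2 = 9893 + 1389 * b - 378 * b ^ 2) :
    -(30411 + 4270 * b - 1162 * b ^ 2) - 5 = x ^ 6 * ((-39105508 : R) + (-25488374 : R) * b + (-4063186 : R) * b ^ 2) := by
  linear_combination ((-23874 : R) + (-12412038 : R) * x ^ 2 + (-5526724326 : R) * x ^ 4 + (-8316 : R) * b + (-3457188 : R) * b * x ^ 2 + (-1535884308 : R) * b * x ^ 4) * Rb + ((172 : R) + (87824 : R) * x ^ 2 + (39105508 : R) * x ^ 4 + (122 : R) * b + (57298 : R) * b * x ^ 2 + (25488374 : R) * b * x ^ 4 + (22 : R) * b ^ 2 + (9146 : R) * b ^ 2 * x ^ 2 + (4063186 : R) * b ^ 2 * x ^ 4) * Rx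

/-- ★ **The layer-two non-norm unit of the cubic of discriminant `9980`, MODEL-FREE**: `K ⊆ F ⊆ E` number fields with `[K:ℚ] = 3`, `[F:K] = [E:F] = 2`,
`b ∈ 𝓞 K` a root of the cubic, `s ∈ F` with `s² = 2`, `t ∈ E` with `t² = 2 + s`, `h(E)` odd ⟹ the cubic unit `−u` is not a norm from `E(√(2+t))`:
`a² − (2 + t)c² ≠ −u` for all `a, c ∈ E` (k4-w1's layer-one data `layer_one_dyadic_d9980` / `layer_one_ids_d9980`, the certificate §1, and GEN 15's
`exists_unit_forall_sq_sub_mul_sq_ne_of_layerOneData`).  All arithmetic over the ABSTRACT fields (cheap kernel); the concrete layers only instantiate.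
[cite: Omeara1963, §63B (63:10) and §63A (63:3)] [cite: Washington1997, §13.1] [cite: Lang1990, Ch. 13 §4] -/
theorem exists_unit_forall_sq_sub_mul_sq_ne_layerTwo_d9980 (K F E : Type) [Field K] [NumberField K] [Field F] [NumberField F]
    [Field E] [NumberField E] [Algebra K F] [Algebra F E]
    (h3 : Module.finrank ℚ K = 3) (h2 : Module.finrank K F = 2) (h2' : Module.finrank F E = 2) (b : 𝓞 K)
    (hb : b ^ 3 + (-1 : ℤ) * b ^ 2 + (-36 : ℤ) * b + (-70 : ℤ) = 0) (s : F) (hs : s ^ 2 = 2)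
    (hodd : Odd (classNumber E)) (t : E) (ht : t ^ 2 = algebraMap F E (2 + s)) :
    ∃ η : (𝓞 E)ˣ, ∀ a c : E, a ^ 2 - (2 + t) * c ^ 2 ≠ ((η : 𝓞 E) : E) := by
  have hcoe1 : ∀ y : 𝓞 F, algebraMap (𝓞 F) F y = ((y : 𝓞 F) : F) := fun y => (NumberField.RingOfIntegers.coe_eq_algebraMap y).symm
  obtain ⟨bF, xF, -, -, RbF, RxF, hSP, hprime, hres⟩ := layer_one_dyadic_d9980 K F h3 h2 b hb s hs
  obtain ⟨htwo, hpz, hmuz, hximu, huinv, -, -⟩ := layer_one_ids_d9980 bF xF RbF RxF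
  have hwz : (-8 - 3 * bF) ^ 2 - 1 = xF * (((-1233 : 𝓞 F) * xF + (-798 : 𝓞 F) * bF * xF + (-126 : 𝓞 F) * bF ^ 2 * xF) * ((-8 - 3 * bF) + 1)) := by
    linear_combination ((-8 - 3 * bF) + 1) * hpz
  have hsF : (xF * (-8 - 3 * bF)) ^ 2 = 2 := by linear_combination htwo
  have hεinv : (-(30411 + 4270 * bF - 1162 * bF ^ 2)) * (-((411 : 𝓞 F) + (266 : 𝓞 F) * bF + (42 : 𝓞 F) * bF ^ 2)) = 1 := by rw [neg_mul_neg]; exact huinv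
  have hc6 := layer_two_unit_cert_d9980 bF xF RbF RxF
  have hsFval : (((xF * (-8 - 3 * bF) : 𝓞 F)) : F) = s := hSP
  exact exists_unit_forall_sq_sub_mul_sq_ne_of_layerOneData F E h2' hprime hres htwo hwz hximu hmuz hsF hεinv hc6
    hodd t (by rw [IsScalarTower.algebraMap_apply (𝓞 F) F E, map_add, map_ofNat, hcoe1, hsFval]; exact ht)

section Row

variable {θ : AlgebraicClosure ℚ}

set_option maxHeartbeats 3200000 in
set_option synthInstance.maxHeartbeats 400000 in
/-- ★ **`h(A₃) = h(ℚ(θ) ⊔ ℚ_3)` is ODD for `θ³ + (-1)θ² + (-36)θ + (-70) = 0`** (`A₃ = ℚ(θ)·ℚ(ζ₃₂)⁺`, degree `24`): the generic parity step at `m = 2` — `h(A₂)` odd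
(`odd_classNumber_sup_layer_two_d9980p_lb`), Fukuda index `0`, at most two dyadic primes, and for every root `t ∈ A₂` of `Ψ₂` the cubic unit `−u`, not a norm from
`A₂(√(2+t))` (`exists_unit_forall_sq_sub_mul_sq_ne_of_layerOneData` with k4-w1's layer-one data at `s = t² − 2 ∈ A₁` and §1).  KERNEL; discharges the displayed `hL` of
`conjA_two_279440c1_of_layerBounds₂₃` (eng-2 v1.3: `h(K₃)` odd). [cite: Lang1990, Ch. 13 §4, Lemma 4.1 (PDF pp. 203–204)] [cite: Gras2003, IV.4] [cite: Omeara1963, §63B (63:10)]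
[cite: Washington1997, §13.1 Prop. 13.2] -/
theorem odd_classNumber_sup_layer_three_d9980p_lb (hθ : aeval θ (Cubic.toPoly ⟨1, ((-1 : ℤ) : ℚ), ((-36 : ℤ) : ℚ), ((-70 : ℤ) : ℚ)⟩) = 0) :
    haveI : FiniteDimensional ℚ ↥ℚ⟮θ⟯ :=
      IntermediateField.adjoin.finiteDimensional ⟨_, Cubic.monic_of_a_eq_one', by rwa [← aeval_def]⟩
    haveI : FiniteDimensional ℚ ↥((CyclotomicZp.zpExtension 2).layer (2 + 1)) := (CyclotomicZp.zpExtension 2).finiteDimensional_layer_holds (2 + 1)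
    haveI : NumberField ↥(ℚ⟮θ⟯ ⊔ (CyclotomicZp.zpExtension 2).layer (2 + 1)) := NumberField.mk
    Odd (classNumber ↥(ℚ⟮θ⟯ ⊔ (CyclotomicZp.zpExtension 2).layer (2 + 1))) := by
  haveI : Fact (Nat.Prime 2) := ⟨Nat.prime_two⟩
  haveI : FiniteDimensional ℚ ↥ℚ⟮θ⟯ :=
    IntermediateField.adjoin.finiteDimensional ⟨_, Cubic.monic_of_a_eq_one', by rwa [← aeval_def]⟩
  haveI : FiniteDimensional ℚ ↥((CyclotomicZp.zpExtension 2).layer 1) := (CyclotomicZp.zpExtension 2).finiteDimensional_layer_holds 1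
  haveI : FiniteDimensional ℚ ↥((CyclotomicZp.zpExtension 2).layer 2) := (CyclotomicZp.zpExtension 2).finiteDimensional_layer_holds 2
  haveI : NumberField ↥ℚ⟮θ⟯ := NumberField.mk
  haveI : NumberField ↥(ℚ⟮θ⟯ ⊔ (CyclotomicZp.zpExtension 2).layer 1) := NumberField.mk
  haveI : NumberField ↥(ℚ⟮θ⟯ ⊔ (CyclotomicZp.zpExtension 2).layer 2) := NumberField.mk
  have h3 : Module.finrank ℚ ↥ℚ⟮θ⟯ = 3 := finrank_adjoin_eq_three_of_irreducible irreducible_cubic_d9980p hθ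
  obtain ⟨b, -, hb⟩ := exists_ringOfIntegers_cubic_root (p := -1) (q := -36) (r := -70) hθ
  have h2 : {w : HeightOneSpectrum (𝓞 ↥ℚ⟮θ⟯) | ((2 : ℕ) : 𝓞 ↥ℚ⟮θ⟯) ∈ w.asIdeal}.ncard ≤ 2 :=
    ncard_primes_above_two_le_two ↥ℚ⟮θ⟯ h3 b irreducible_cubic_d9980p hb ⟨0, by norm_num⟩ ⟨0, by norm_num⟩
  obtain ⟨-, hfin1, -⟩ := layer_basics irreducible_cubic_d9980p hθ (isTotallyReal_adjoin_d9980p_lb hθ) 1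
  obtain ⟨-, hfin2, -⟩ := layer_basics irreducible_cubic_d9980p hθ (isTotallyReal_adjoin_d9980p_lb hθ) 2
  -- the tower `ℚ(θ) ≤ A₁ ≤ A₂`
  have hK1 : ℚ⟮θ⟯ ≤ ℚ⟮θ⟯ ⊔ (CyclotomicZp.zpExtension 2).layer 1 := le_sup_left
  have h12 : ℚ⟮θ⟯ ⊔ (CyclotomicZp.zpExtension 2).layer 1 ≤ ℚ⟮θ⟯ ⊔ (CyclotomicZp.zpExtension 2).layer 2 :=
    sup_le_sup_left ((CyclotomicZp.zpExtension 2).layer_mono (by norm_num : 1 ≤ 2)) _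
  letI : Algebra ↥ℚ⟮θ⟯ ↥(ℚ⟮θ⟯ ⊔ (CyclotomicZp.zpExtension 2).layer 1) := (IntermediateField.inclusion hK1).toRingHom.toAlgebra
  letI : Algebra ↥(ℚ⟮θ⟯ ⊔ (CyclotomicZp.zpExtension 2).layer 1) ↥(ℚ⟮θ⟯ ⊔ (CyclotomicZp.zpExtension 2).layer 2) :=
    (IntermediateField.inclusion h12).toRingHom.toAlgebra
  have halg12 : ∀ c, algebraMap ↥(ℚ⟮θ⟯ ⊔ (CyclotomicZp.zpExtension 2).layer 1) ↥(ℚ⟮θ⟯ ⊔ (CyclotomicZp.zpExtension 2).layer 2) c =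
      IntermediateField.inclusion h12 c := fun _ => rfl
  haveI : IsScalarTower ℚ ↥ℚ⟮θ⟯ ↥(ℚ⟮θ⟯ ⊔ (CyclotomicZp.zpExtension 2).layer 1) :=
    IsScalarTower.of_algebraMap_eq fun x => ((IntermediateField.inclusion hK1).commutes x).symm
  haveI : IsScalarTower ℚ ↥(ℚ⟮θ⟯ ⊔ (CyclotomicZp.zpExtension 2).layer 1) ↥(ℚ⟮θ⟯ ⊔ (CyclotomicZp.zpExtension 2).layer 2) :=
    IsScalarTower.of_algebraMap_eq fun x => ((IntermediateField.inclusion h12).commutes x).symm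
  haveI : Module.Finite ↥ℚ⟮θ⟯ ↥(ℚ⟮θ⟯ ⊔ (CyclotomicZp.zpExtension 2).layer 1) := Module.Finite.of_restrictScalars_finite ℚ _ _
  haveI : Module.Finite ↥(ℚ⟮θ⟯ ⊔ (CyclotomicZp.zpExtension 2).layer 1) ↥(ℚ⟮θ⟯ ⊔ (CyclotomicZp.zpExtension 2).layer 2) :=
    Module.Finite.of_restrictScalars_finite ℚ _ _
  have hdeg : Module.finrank ↥ℚ⟮θ⟯ ↥(ℚ⟮θ⟯ ⊔ (CyclotomicZp.zpExtension 2).layer 1) = 2 := by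
    have htower := Module.finrank_mul_finrank ℚ ↥ℚ⟮θ⟯ ↥(ℚ⟮θ⟯ ⊔ (CyclotomicZp.zpExtension 2).layer 1)
    rw [h3, hfin1] at htower
    omega
  have hdeg2 : Module.finrank ↥(ℚ⟮θ⟯ ⊔ (CyclotomicZp.zpExtension 2).layer 1) ↥(ℚ⟮θ⟯ ⊔ (CyclotomicZp.zpExtension 2).layer 2) = 2 := by
    have htower := Module.finrank_mul_finrank ℚ ↥(ℚ⟮θ⟯ ⊔ (CyclotomicZp.zpExtension 2).layer 1) ↥(ℚ⟮θ⟯ ⊔ (CyclotomicZp.zpExtension 2).layer 2)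
    rw [hfin1, hfin2] at htower
    omega
  refine odd_classNumber_sup_layer_succ_of_nonNormUnit irreducible_cubic_d9980p hθ (isTotallyReal_adjoin_d9980p_lb hθ)
    (forall_totallyRamifiedFrom_zero_h279440c1 hθ) h2 2 (by norm_num) (odd_classNumber_sup_layer_two_d9980p_lb hθ) ?_
  intro _ t ht
  -- `u = t ∈ ℚ̄`; `s' = u² − 2 ∈ A₁`, `s'² = 2`, `t² = 2 + s'`
  obtain ⟨u, hu⟩ : ∃ u : AlgebraicClosure ℚ, algebraMap ↥(ℚ⟮θ⟯ ⊔ (CyclotomicZp.zpExtension 2).layer 2) (AlgebraicClosure ℚ) t = u := ⟨_, rfl⟩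
  obtain ⟨s₀, hs₀, hs₀2⟩ := CyclotomicZp.exists_mem_layer_one_sq_eq_two_zpExtension
  have htQ : (u ^ 2 - 2) ^ 2 = 2 := by
    have h := congrArg (algebraMap ↥(ℚ⟮θ⟯ ⊔ (CyclotomicZp.zpExtension 2).layer 2) (AlgebraicClosure ℚ)) ht
    rw [NestedSqrtTwo.map_iterate, map_zero, iterate_sq_sub_two_two, hu] at h
    linear_combination h
  have hsmem : u ^ 2 - 2 ∈ ℚ⟮θ⟯ ⊔ (CyclotomicZp.zpExtension 2).layer 1 := by
    have hprod : (u ^ 2 - 2 - s₀) * (u ^ 2 - 2 + s₀) = 0 := by linear_combination htQ - hs₀2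
    rcases mul_eq_zero.mp hprod with h | h
    · have : u ^ 2 - 2 = s₀ := by linear_combination h
      rw [this]; exact (le_sup_right : (CyclotomicZp.zpExtension 2).layer 1 ≤ _) hs₀
    · have : u ^ 2 - 2 = -s₀ := by linear_combination h
      rw [this]; exact neg_mem ((le_sup_right : (CyclotomicZp.zpExtension 2).layer 1 ≤ _) hs₀)
  obtain ⟨s', hs'val⟩ : ∃ s' : ↥(ℚ⟮θ⟯ ⊔ (CyclotomicZp.zpExtension 2).layer 1),
      algebraMap ↥(ℚ⟮θ⟯ ⊔ (CyclotomicZp.zpExtension 2).layer 1) (AlgebraicClosure ℚ) s' = u ^ 2 - 2 :=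
    ⟨⟨u ^ 2 - 2, hsmem⟩, IntermediateField.algebraMap_apply _ _⟩
  have hs' : s' ^ 2 = 2 := by
    apply (algebraMap ↥(ℚ⟮θ⟯ ⊔ (CyclotomicZp.zpExtension 2).layer 1) (AlgebraicClosure ℚ)).injective
    rw [map_pow, hs'val, map_ofNat]
    exact htQ
  have htow : ∀ x : ↥(ℚ⟮θ⟯ ⊔ (CyclotomicZp.zpExtension 2).layer 1),
      algebraMap ↥(ℚ⟮θ⟯ ⊔ (CyclotomicZp.zpExtension 2).layer 2) (AlgebraicClosure ℚ)
        (algebraMap ↥(ℚ⟮θ⟯ ⊔ (CyclotomicZp.zpExtension 2).layer 1) ↥(ℚ⟮θ⟯ ⊔ (CyclotomicZp.zpExtension 2).layer 2) x) =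
      algebraMap ↥(ℚ⟮θ⟯ ⊔ (CyclotomicZp.zpExtension 2).layer 1) (AlgebraicClosure ℚ) x := by
    intro x
    rw [halg12, IntermediateField.algebraMap_apply, IntermediateField.algebraMap_apply, IntermediateField.coe_inclusion]
  have ht2 : t ^ 2 = algebraMap ↥(ℚ⟮θ⟯ ⊔ (CyclotomicZp.zpExtension 2).layer 1) ↥(ℚ⟮θ⟯ ⊔ (CyclotomicZp.zpExtension 2).layer 2) (2 + s') := by
    apply (algebraMap ↥(ℚ⟮θ⟯ ⊔ (CyclotomicZp.zpExtension 2).layer 2) (AlgebraicClosure ℚ)).injective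
    rw [map_pow, hu, htow, map_add, map_ofNat, hs'val]
    ring
  -- k4-w1's layer-one data at `s'` and the generic layer-two non-norm unit (model-free lemma above)
  exact exists_unit_forall_sq_sub_mul_sq_ne_layerTwo_d9980 ↥ℚ⟮θ⟯ ↥(ℚ⟮θ⟯ ⊔ (CyclotomicZp.zpExtension 2).layer 1)
    ↥(ℚ⟮θ⟯ ⊔ (CyclotomicZp.zpExtension 2).layer 2) h3 hdeg hdeg2 b hb s' hs' (odd_classNumber_sup_layer_two_d9980p_lb hθ) t ht2

/-- ★ **(A) at `2` for `279440c1` with `hK` AND `hL` DISCHARGED: two displayed data (hlow) `2^3 ≤ #(U⁺/U²)(A₂)`, (hsig) `2^21 ≤ #sign(U_{A₃})`** (VALUED GRH-free by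
eng-2 CERT-NARROW6-E2 v1.3 §6.1; instrument tier): `conjA_two_279440c1_of_layerBounds₂₃'` with `hL := odd_classNumber_sup_layer_three_d9980p_lb hθ`.
BSD for `279440c1` is NOT proved by this. [cite: EdgarMollinPeterson1986, Thm. 2.1, p. 34] [cite: Fukuda1994, Thm. 1 (2), p. 264] [cite: CoatesSujatha2005, Conj. A and Thm. 3.4] -/
theorem conjA_two_279440c1_of_layerBounds₂₃''
    (hθ : aeval θ (Cubic.toPoly ⟨1, ((-1 : ℤ) : ℚ), ((-36 : ℤ) : ℚ), ((-70 : ℤ) : ℚ)⟩) = 0)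
    (hlow : ∀ [NumberField ↥(ℚ⟮θ⟯ ⊔ (CyclotomicZp.zpExtension 2).layer 2)],
      2 ^ 3 ≤ Nat.card (TotPosUnitsModSq ↥(ℚ⟮θ⟯ ⊔ (CyclotomicZp.zpExtension 2).layer 2)))
    (hsig : ∀ [NumberField ↥(ℚ⟮θ⟯ ⊔ (CyclotomicZp.zpExtension 2).layer (2 + 1))],
      2 ^ 21 ≤ Nat.card (Set.range (signVec (K := ↥(ℚ⟮θ⟯ ⊔ (CyclotomicZp.zpExtension 2).layer (2 + 1))))))
    (κ : ZpExtension ℚ 2) (hκ : κ.IsCyclotomic) :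
    haveI := (isElliptic_cubicModel _ _ _ (by simp only [Cubic.discr]; norm_num) : (⟨0, ((1 : ℤ) : ℚ), 0, ((-114041197436 : ℤ) : ℚ), ((-14823196533966296 : ℤ) : ℚ)⟩ : WeierstrassCurve ℚ).IsElliptic)
    ∃ (γ : absoluteGaloisGroup ℚ) (D : (⟨0, ((1 : ℤ) : ℚ), 0, ((-114041197436 : ℤ) : ℚ), ((-14823196533966296 : ℤ) : ℚ)⟩ : WeierstrassCurve ℚ).FineSelmerDualData κ γ),
      Module.Finite ℤ_[2] (RestrictScalars ℤ_[2] (IwasawaAlgebra 2) D.X) :=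
  conjA_two_279440c1_of_layerBounds₂₃' hθ (odd_classNumber_sup_layer_three_d9980p_lb hθ) hlow hsig κ hκ

end Row

end Summit.BirchSwinnertonDyer.BirchSwinnertonDyer.Theorems.AddKatoTwo

/-! ## §3 The C3″ rungs with `hK`, `hL` discharged (namespace `AddPotGoodInstances`) -/

namespace Summit.BirchSwinnertonDyer.BirchSwinnertonDyer.Theorems.AddPotGoodInstances

open WeierstrassCurve Polynomial NumberField Literature.NumberTheory.EllipticCurves
  Literature.NumberTheory.IwasawaTheory
  Literature.NumberTheory.NumberFields
  Literature.Geometry.Kaehler.ComplexTorus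
  Literature.NumberTheory.EllipticCurves.Rank1Residual
  Literature.NumberTheory.EllipticCurves.Rank1Residual.Typed
  Summit.BirchSwinnertonDyer.Rank1Residual
  Summit.BirchSwinnertonDyer.Rank1Residual.Additive
  Summit.BirchSwinnertonDyer.BirchSwinnertonDyer.Theorems

/-- Model transport for (A) at `2` in the `∃ γ D` spelling (the statement only depends on the Weierstrass CURVE).
[cite: CoatesSujatha2005, statement (A)] -/
private theorem conjA_two_of_eq_lt279440c1 {W W' : WeierstrassCurve ℚ} (h : W' = W)
    (H : ∀ (κ : ZpExtension ℚ 2), κ.IsCyclotomic →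
      ∃ (γ : Field.absoluteGaloisGroup ℚ) (D : W'.FineSelmerDualData κ γ), Module.Finite ℤ_[2] (RestrictScalars ℤ_[2] (IwasawaAlgebra 2) D.X)) :
    ∀ (κ : ZpExtension ℚ 2), κ.IsCyclotomic →
      ∃ (γ : Field.absoluteGaloisGroup ℚ) (D : W.FineSelmerDualData κ γ), Module.Finite ℤ_[2] (RestrictScalars ℤ_[2] (IwasawaAlgebra 2) D.X) := by
  subst h; exact H

/-- **(A) at `(279440c1, 2)` for the Cremona model from the TWO remaining unit data (`hK`, `hL` kernel), NO print fact.** [cite: CoatesSujatha2005, statement (A)] -/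
theorem conjA_two_279440c1_of_layerBounds₂₃''_kernelLit
    {θ : AlgebraicClosure ℚ} (hθ : aeval θ (Cubic.toPoly ⟨1, ((-1 : ℤ) : ℚ), ((-36 : ℤ) : ℚ), ((-70 : ℤ) : ℚ)⟩) = 0)
    (hlow : ∀ [NumberField ↥(ℚ⟮θ⟯ ⊔ (CyclotomicZp.zpExtension 2).layer 2)],
      2 ^ 3 ≤ Nat.card (TotPosUnitsModSq ↥(ℚ⟮θ⟯ ⊔ (CyclotomicZp.zpExtension 2).layer 2)))
    (hsig : ∀ [NumberField ↥(ℚ⟮θ⟯ ⊔ (CyclotomicZp.zpExtension 2).layer (2 + 1))],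
      2 ^ 21 ≤ Nat.card (Set.range (signVec (K := ↥(ℚ⟮θ⟯ ⊔ (CyclotomicZp.zpExtension 2).layer (2 + 1))))))
    :
    haveI := isElliptic_279440c1
    ∀ (κ : ZpExtension ℚ 2), κ.IsCyclotomic →
      ∃ (γ : Field.absoluteGaloisGroup ℚ) (D : (⟨0, 1, 0, -114041197436, -14823196533966296⟩ : WeierstrassCurve ℚ).FineSelmerDualData κ γ),
        Module.Finite ℤ_[2] (RestrictScalars ℤ_[2] (IwasawaAlgebra 2) D.X) :=
  conjA_two_of_eq_lt279440c1 (W' := (⟨0, ((1 : ℤ) : ℚ), 0, ((-114041197436 : ℤ) : ℚ), ((-14823196533966296 : ℤ) : ℚ)⟩ : WeierstrassCurve ℚ)) (by norm_num)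
    (fun κ hκ ↦ AddKatoTwo.conjA_two_279440c1_of_layerBounds₂₃'' hθ hlow hsig κ hκ)

/-- **`BSD₂(279440c1)` with (A) from the TWO remaining unit data (`hK`, `hL` kernel) and NO print fact for (A)**: GEN 3's rung `bsdp_two_279440c1_of_conjA`.
Conditional on PRINT {`hSharp` (reading), `hGZK`, `hmod`, `hCT`}, RECORD `hr`, `#Ш_an = q`, the two VALUED slots and the two VALUED unit data (hlow, hsig).
Nothing booked; BSD is not proved by this. [cite: Kato2004Asterisque, Thm. 12.5 (1)(3), 13.8, 14.14] [cite: EdgarMollinPeterson1986, Thm. 2.1] [cite: Miller2011LMS, Def. 1.1] -/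
theorem bsdp_two_279440c1_layerBounds₂₃''
    (hSharp : Kato2004.rankZero_padicValNat_sha_add_padicValNat_tamagawa_le_at_two_of_irreducible_of_fineSelmerDual_fg)
    (hGZK : rank_eq_analyticRank_of_analyticRank_le_one) (hmod : hasEntireLFunction_rat)
    (hCT : exists_casselsTate_pairing (K := ℚ))
    {θ : AlgebraicClosure ℚ} (hθ : aeval θ (Cubic.toPoly ⟨1, ((-1 : ℤ) : ℚ), ((-36 : ℤ) : ℚ), ((-70 : ℤ) : ℚ)⟩) = 0)
    (hlow : ∀ [NumberField ↥(ℚ⟮θ⟯ ⊔ (CyclotomicZp.zpExtension 2).layer 2)],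
      2 ^ 3 ≤ Nat.card (TotPosUnitsModSq ↥(ℚ⟮θ⟯ ⊔ (CyclotomicZp.zpExtension 2).layer 2)))
    (hsig : ∀ [NumberField ↥(ℚ⟮θ⟯ ⊔ (CyclotomicZp.zpExtension 2).layer (2 + 1))],
      2 ^ 21 ≤ Nat.card (Set.range (signVec (K := ↥(ℚ⟮θ⟯ ⊔ (CyclotomicZp.zpExtension 2).layer (2 + 1))))))
    (hr : haveI := isElliptic_279440c1; (⟨0, 1, 0, -114041197436, -14823196533966296⟩ : WeierstrassCurve ℚ).analyticRank = 0)
    (hs₁ : Nat.card ((⟨0, 1, 0, -114041197436, -14823196533966296⟩ : WeierstrassCurve ℚ).selmerGroup (2 ^ 2)) = 2 ^ 4)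
    (hs₂ : Nat.card ((⟨0, 1, 0, -114041197436, -14823196533966296⟩ : WeierstrassCurve ℚ).selmerGroup (2 ^ (2 + 1))) = 2 ^ 6)
    {q : ℚ} (hq : haveI := isElliptic_279440c1; shaAn (⟨0, 1, 0, -114041197436, -14823196533966296⟩ : WeierstrassCurve ℚ) = (q : ℂ)) (hv : padicValRat 2 q ≤ 6) :
    haveI := isElliptic_279440c1; haveI := isGloballyMinimal_279440c1
    BSDp (⟨0, 1, 0, -114041197436, -14823196533966296⟩ : WeierstrassCurve ℚ) 2 := by
  exact bsdp_two_279440c1_of_conjA hSharp hGZK hmod hCT (conjA_two_279440c1_of_layerBounds₂₃''_kernelLit hθ hlow hsig) hr hs₁ hs₂ hq hv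

/-- **`BSD₂` ON THE WHOLE CLASS of `279440c1` with (A) from the TWO remaining unit data (`hK`, `hL` kernel) and NO print fact for (A)**: GEN 3's class rung (Cassels
transport `hCassels`).  Nothing booked; BSD is not proved by this. [cite: Cassels1965ArithmeticVIII, Thm. 1.3] [cite: Kato2004Asterisque, Thm. 12.5 (1)(3)] -/
theorem bsdp_two_of_isIsogenous_279440c1_layerBounds₂₃''
    (hSharp : Kato2004.rankZero_padicValNat_sha_add_padicValNat_tamagawa_le_at_two_of_irreducible_of_fineSelmerDual_fg)
    (hGZK : rank_eq_analyticRank_of_analyticRank_le_one) (hmod : hasEntireLFunction_rat)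
    (hCT : exists_casselsTate_pairing (K := ℚ)) (hCassels : bsdRHS_eq_of_isIsogenous)
    {θ : AlgebraicClosure ℚ} (hθ : aeval θ (Cubic.toPoly ⟨1, ((-1 : ℤ) : ℚ), ((-36 : ℤ) : ℚ), ((-70 : ℤ) : ℚ)⟩) = 0)
    (hlow : ∀ [NumberField ↥(ℚ⟮θ⟯ ⊔ (CyclotomicZp.zpExtension 2).layer 2)],
      2 ^ 3 ≤ Nat.card (TotPosUnitsModSq ↥(ℚ⟮θ⟯ ⊔ (CyclotomicZp.zpExtension 2).layer 2)))
    (hsig : ∀ [NumberField ↥(ℚ⟮θ⟯ ⊔ (CyclotomicZp.zpExtension 2).layer (2 + 1))],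
      2 ^ 21 ≤ Nat.card (Set.range (signVec (K := ↥(ℚ⟮θ⟯ ⊔ (CyclotomicZp.zpExtension 2).layer (2 + 1))))))
    {W : WeierstrassCurve ℚ} [W.IsElliptic] [W.IsGloballyMinimal]
    (hiso : haveI := isElliptic_279440c1; IsIsogenous W (⟨0, 1, 0, -114041197436, -14823196533966296⟩ : WeierstrassCurve ℚ)) (hr : W.analyticRank = 0)
    (hs₁ : Nat.card ((⟨0, 1, 0, -114041197436, -14823196533966296⟩ : WeierstrassCurve ℚ).selmerGroup (2 ^ 2)) = 2 ^ 4)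
    (hs₂ : Nat.card ((⟨0, 1, 0, -114041197436, -14823196533966296⟩ : WeierstrassCurve ℚ).selmerGroup (2 ^ (2 + 1))) = 2 ^ 6)
    {q : ℚ} (hq : haveI := isElliptic_279440c1; shaAn (⟨0, 1, 0, -114041197436, -14823196533966296⟩ : WeierstrassCurve ℚ) = (q : ℂ)) (hv : padicValRat 2 q ≤ 6) :
    BSDp W 2 := by
  exact bsdp_two_of_isIsogenous_279440c1_of_conjA hSharp hGZK hmod hCT hCassels (conjA_two_279440c1_of_layerBounds₂₃''_kernelLit hθ hlow hsig) hiso hr hs₁ hs₂ hq hv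

end Summit.BirchSwinnertonDyer.BirchSwinnertonDyer.Theorems.AddPotGoodInstances

end
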